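/-
Origin: expansion seat `prover-pub-hodgecm-mc-binder-2-g12-0`, handover #53 2026-08-20T05:20Z md5 fa3a899212d7 (340 l.; CERTIFIED private mirror over PKG RUN-39 oleans + privately rebuilt #52: rc 0 / 0 err / 0 warn / 98 s; `#print axioms` of pair_cmAdelicEquiv_jT₃₄_toAdeles · omgW_ins₃₄_vacuum_datumAt_eq_of_weight · ins₃₄_mem_SK ⊆ {propext, Classical.choice, Quot.sound} (`g12/certs/axioms-53-54.log`); imports #52 `HypCensus/IsoTwist` (RUN 41), #39 `HypCensus/OmgInsPinChoice` (RUN 39), period-1 `Model/ArchSideTerm` (RUN 37; for `ArchSideTerm.dW'`/`isoGL_hg₀`); (J-T34) THE (34) SIDE OF `HypSideW (W V c) c.D.jT₃₄ …` AS THE (12) SIDE TRANSPORTED BY ONE ARCHIMEDEAN OPERATOR: §1 `isoTwistPin S` (#52 at `g := S.isoGL`), `swapPin S` (place-wise swap), `wPair`, `archConjDiag_isoGL_eq` (the (34) chart element = `h · archDiag (dW S) (swapPin S u) · h⁻¹`), **`pair_cmAdelicEquiv_jT₃₄_toAdeles : (1, cmAdelicEquiv (S.jT₃₄ (toAdeles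 u))) = wPair V S (h · diag(swap u) · h⁻¹)`** (#25 `cmAdelicEquiv_jT₃₄_toAdeles` + #52 headline); §2 **`isoOp := ρ_η(archProdHom (1, h))`**, **`ins₃₄ := isoOp ∘ₗ ins`** (the (34) insertion), `cmPairRepTwist_jT₃₄_isoOp` (`ρ(1, eW (jT₃₄ (ι u))) ∘ isoOp = isoOp ∘ ρ(wPair (archDiag (swap u)))`, group algebra), `cmPairRepTwist_jT₃₄_ins₃₄_smul_vacuum` (value currency, from #37 `cmPairRepTwist_jT₁₂_ins_smul_vacuum` at `swapPin S u`); §3 **`omgW_ins₃₄_smul_vacuum_eq_of_weight`** (general datum: the census field `omg_ins` AT `a • φ₀` for the torus `jT₃₄` at `W₀ = wmInputCM₂g V S hGR η hη hηc τ T hT` from ONE scalar identity `hμ` read at `swapPin S (archOf t)`) and **`omgW_ins₃₄_vacuum_datumAt_eq_of_weight`** (the (34) twin of #39 for `datumAt V S jD (jIOf V S hW)`, per-place scalars `dAt`); §4 **`ins₃₄_mem_SK`**: `ins f φ ∈ W₀.SK → ins₃₄ f φ ∈ W₀.SK` (`W₀.SK_stable`; NO new hypothesis — with RUN-41 #51 `ins_mem_datumAt`,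 the (34) `ins_mem` is closed mod the SAME `hκ`); 0 Prop-defs / 0 records / 0 proof-hole-class tokens; FQN scan vs PKG RUN-41 world: 0 collisions; NAME LIST `HodgeCM.Model.HypCensus.omgW_ins₃₄_vacuum_datumAt_eq_of_weight` · `HodgeCM.Model.HypCensus.pair_cmAdelicEquiv_jT₃₄_toAdeles` · `HodgeCM.Model.HypCensus.ins₃₄_mem_SK`) (`HOME/mc/pub-hodgecm-mc-binder-2/g12/pkg/HodgeCM/Model/HypCensus/Side34Omg.lean`, md5 fa3a899212d7, 340 lines);
landed by the second packager p2 gen 3 (p2-g3) in gate run 42 as `HodgeCM/Model/HypCensus/Side34Omg.lean` (verbatim).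
-/
/-
Origin: speedrun cell pub-hodgecm, MODEL-CONSTRUCTION sub-cell, lineage mc-binder-2 (BINDER-OWNERS rows 18/19: E binders
`hyp12` / `hyp34`), seat prover-pub-hodgecm-mc-binder-2-g12-0 (gen 12), 2026-08-20.
Target in PKG: `HodgeCM/Model/HypCensus/Side34Omg.lean` (NEW additive leaf; imports this lineage's `HypCensus/IsoTwist` (#52),
`HypCensus/OmgInsPinChoice` (#39, RUN 39) and period-1's `Model/ArchSideTerm` (RUN 37)).  KERNEL ONLY: 0 records, nothing cited, 0 `def … : Prop`.
-/
import Summits.HodgeConjecture.HodgeCM.Model.HypCensus.IsoTwist_2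
import Summits.HodgeConjecture.HodgeCM.Model.HypCensus.OmgInsPinChoice
import Summits.HodgeConjecture.HodgeCM.Model.ArchSideTerm

/-!
# Census kit (rows A12/A34): the (34) side of `HypSideW` as the (12) side transported by `ρ_η(1, isoTwist)`

Row 19 (`hyp34`) asks for `HypCoreW (W V c) c.D.jT₃₄ (-μ c 2) (-μ c 3)` on the SAME `W` as row 18.  By #52 (`IsoTwist`) the (34) chart
element is `(h · diag(swap u) · h⁻¹)_𝔸`, `h = isoTwist isoGL ∈ U(W)(L⁺ ⊗ ℝ)`; so with the (34) insertion
**`ins₃₄ := ρ_η(1, h_𝔸) ∘ ins`** the (34) fields reduce to the (12)-type ones: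

* `pair_cmAdelicEquiv_jT₃₄_toAdeles` — the chart pair of `jT₃₄ (ι u)` IS `archProdHom (1, h · diag(swap u) · h⁻¹)`;
* `cmPairRepTwist_jT₃₄_isoOp` — `ρ(1, eW (jT₃₄ (ι u))) ∘ ρ(1,h) = ρ(1,h) ∘ ρ(1, diag(swap u))` (group algebra);
* **`omgW_ins₃₄_smul_vacuum_eq_of_weight`** / **`…_datumAt_…`** — the census field `omg_ins` AT `a • φ₀` for the torus `jT₃₄` from ONE
  scalar identity `hμ₃₄` on `T(L⁺ ⊗ ℝ)` (the (34) analogue of #37/#39's `hμ`, read at `swap u`);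
* **`ins₃₄_mem_SK`** — `ins₃₄ f φ ∈ 𝒮^κ` whenever `ins f φ ∈ 𝒮^κ` (`W₀.SK_stable`: `𝒮^κ` is `ρ(1,·)`-stable) — NO new hypothesis.

Nothing here is a claim of PerL/QW8.  Style lint (L-notation): no `local notation`.
-/

set_option autoImplicit false

noncomputable section

open Filter Topology
open NumberField NumberField.InfinitePlace
open scoped TensorProduct Classical
open MvPolynomial
open Literature.NumberTheory.Automorphic Literature.NumberTheory.Automorphic.UnitaryGroup Literature.NumberTheory.Weil1964
open Literature.RepresentationTheory.KonnoKonno2007 Literature.RepresentationTheory.KonnoKonno2007.RealDualPair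
open Literature.NumberTheory.GelbartRogawski1991 Literature.NumberTheory.GelbartRogawski1991.UnitaryDualPair
open Literature.Analysis.SegalBargmann
open HodgeCM HodgeCM.Model HodgeCM.Adelic
open HodgeCM.PerL34.Fock HodgeCM.PerL34.Fock.PrintDict
open NumberField.SeesawArchTorus

namespace HodgeCM.Model.HypCensus

section Pin

variable {L : CMField} {ι₁ : L →+* ℂ} (V : HermSpace3 L ι₁) (S : StubTree.SeesawDatum L)
variable
  (hGR : (cmSplittingDatum (L : Type) finProdFinEquiv (frameD V) (frameD_real V) (frameD_ne V) (dW S) (dW_real S) (dW_ne S)).CompatibleSplitting)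
  (η : CMAdelic (L : Type) (frameD V) × CMAdelic (L : Type) (dW S) →* ℂˣ)
  (hη : ∀ γU ∈ CMRat (L : Type) (frameD V), ∀ γ ∈ CMRat (L : Type) (dW S), η (γU, γ) = 1)
  (hηc : Continuous fun p => ((η p : ℂˣ) : ℂ))
  (τ : L →+* ℂ) (T : GL (Fin 3) ℂ)
  (hT : formCongr (starRingEnd ℂ) T (V.Hm.map τ) = Literature.Geometry.ComplexHyperbolic.BallModel.J)
variable (datum : ∀ b : InfinitePlace (L : Type),
  PlaceDatum (L : Type) (frameD V) (frameD_real V) (dW S) (dW_real S) ι₁ (cmPlacesEquiv (L : Type) b))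
variable (m₁ m₂ : InfinitePlace (L : Type) → ℤ)
variable (hW : (∀ j, 0 < (ι₁ ((dW S) j)).re) ∨ ∀ j, (ι₁ ((dW S) j)).re < 0)

/-! ## §1 The twist of the pin and the (34) chart pair -/

/-- **the archimedean twist of the pin** `h ∈ U(diag(a₀,a₁))(L⁺ ⊗ ℝ)` (#52 at `g := D.isoGL : diag(a₂,a₃) ⥲ diag(a₀,a₁)`). -/
abbrev isoTwistPin : UnitaryGroup.arch (↥(maximalRealSubfield L)) (L : Type) (IsCMField.complexConj L) 2 (Matrix.diagonal (dW S)) :=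
  isoTwist (L : Type) (dW S) (ArchSideTerm.dW' S) (dW_real S) (dW_ne S) (ArchSideTerm.dW'_real S) (ArchSideTerm.dW'_ne S) S.isoGL
    (ArchSideTerm.isoGL_hg₀ S)

/-- the place-wise swap of the torus coordinates attached to the pin (identity where the signs of `(a₂,a₃)` and `(a₀,a₁)` agree in order). -/
abbrev swapPin : SeesawArchTorus (L : Type) →* SeesawArchTorus (L : Type) :=
  torusSwap (L : Type) fun w => (placePerm (L : Type) (dW S) (ArchSideTerm.dW' S) w).symm

/-- `y ↦ archProdHom (1, y)`: the `W`-factor of the archimedean pair group into the pin's adelic pair group. -/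
abbrev wPair : UnitaryGroup.arch (↥(maximalRealSubfield L)) (L : Type) (IsCMField.complexConj L) 2 (Matrix.diagonal (dW S)) →*
    CMAdelic (L : Type) (frameD V) × CMAdelic (L : Type) (dW S) :=
  (archProdHom (↥(maximalRealSubfield L)) (L : Type) (IsCMField.complexConj L) 3 2 (Matrix.diagonal (frameD V)) (Matrix.diagonal (dW S))).comp
    (MonoidHom.inr _ _)

/-- (Ported verbatim from the HodgeCMPerL package; no docstring in the source.) -/
theorem wPair_apply (y : UnitaryGroup.arch (↥(maximalRealSubfield L)) (L : Type) (IsCMField.complexConj L) 2 (Matrix.diagonal (dW S))) :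
    wPair V S y = archProdHom (↥(maximalRealSubfield L)) (L : Type) (IsCMField.complexConj L) 3 2 (Matrix.diagonal (frameD V))
      (Matrix.diagonal (dW S)) ((1 : UnitaryGroup.arch (↥(maximalRealSubfield L)) (L : Type) (IsCMField.complexConj L) 3
        (Matrix.diagonal (frameD V))), y) := rfl

/-- **the (34) chart element is `h · diag(swap u) · h⁻¹`** (#52's headline, solved for the chart element). -/
theorem archConjDiag_isoGL_eq (u : SeesawArchTorus (L : Type)) :
    archConjDiag (L : Type) S.isoGL (dW S) (ArchSideTerm.dW' S) (ArchSideTerm.isoGL_hg₀ S) u =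
      isoTwistPin S * archDiag (L : Type) (dW S) (swapPin S u) * (isoTwistPin S)⁻¹ := by
  rw [← isoTwist_conj_archConjDiag (L : Type) (dW S) (ArchSideTerm.dW' S) (dW_real S) (dW_ne S) (ArchSideTerm.dW'_real S)
    (ArchSideTerm.dW'_ne S) S.isoGL (ArchSideTerm.isoGL_hg₀ S) u]
  group

/-- **(J-T34): the chart pair `(1, eW (jT₃₄ (ι u)))` of E IS `archProdHom (1, h · diag(swap u) · h⁻¹)`.** -/
theorem pair_cmAdelicEquiv_jT₃₄_toAdeles (u : SeesawArchTorus (L : Type)) :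
    ((1 : CMAdelic (L : Type) (frameD V)),
      (cmAdelicEquiv (L : Type) 2 (Matrix.diagonal (dW S)) (S.jT₃₄ (toAdeles (L : Type) u)) : CMAdelic (L : Type) (dW S))) =
      wPair V S (isoTwistPin S * archDiag (L : Type) (dW S) (swapPin S u) * (isoTwistPin S)⁻¹) := by
  rw [← archConjDiag_isoGL_eq]
  exact Prod.ext (map_one (archToAdelic (↥(maximalRealSubfield L)) (L : Type) (IsCMField.complexConj L) 3
    (Matrix.diagonal (frameD V)))).symm (cmAdelicEquiv_jT₃₄_toAdeles S u)

/-! ## §2 The transporting operator `ρ_η(1, h)` and the (34) insertion -/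

/-- **`isoOp := ρ_η(archProdHom (1, h))`**, an endomorphism of `𝒮(𝔸^6)`. -/
abbrev isoOp : Module.End ℂ (CMSchwartz (L : Type) 6) :=
  cmPairRepTwist (L : Type) finProdFinEquiv (frameD V) (frameD_real V) (frameD_ne V) (dW S) (dW_real S) (dW_ne S) hGR η
    (wPair V S (isoTwistPin S))

/-- **the (34) insertion**: `ins₃₄ f := ρ_η(1, h) ∘ ins f`. -/
def ins₃₄ (f : FinSB ↥(maximalRealSubfield L) (Fin 6)) :
    (printPlaces (InfinitePlace (L : Type)) (kindOf (L : Type) (frameD V) (frameD_real V) (dW S) (dW_real S) ι₁ datum)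
      (lamOf (L : Type) (frameD V) (frameD_real V) (dW S) (dW_real S) ι₁ datum)
      (lamOf_ne_zero (L : Type) (frameD V) (frameD_real V) (dW S) (dW_real S) ι₁ datum)
      (pinnedVacs (kindOf (L : Type) (frameD V) (frameD_real V) (dW S) (dW_real S) ι₁ datum) m₁ m₂)).F →ₗ[ℂ]
      CMSchwartz (L : Type) 6 :=
  (isoOp V S hGR η) ∘ₗ (ins (L : Type) (frameD V) (frameD_real V) (frameD_ne V) (dW S) (dW_real S) (dW_ne S) ι₁ datum m₁ m₂ f)

/-- (Ported verbatim from the HodgeCMPerL package; no docstring in the source.) -/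
theorem ins₃₄_apply (f : FinSB ↥(maximalRealSubfield L) (Fin 6))
    (φ : (printPlaces (InfinitePlace (L : Type)) (kindOf (L : Type) (frameD V) (frameD_real V) (dW S) (dW_real S) ι₁ datum)
      (lamOf (L : Type) (frameD V) (frameD_real V) (dW S) (dW_real S) ι₁ datum)
      (lamOf_ne_zero (L : Type) (frameD V) (frameD_real V) (dW S) (dW_real S) ι₁ datum)
      (pinnedVacs (kindOf (L : Type) (frameD V) (frameD_real V) (dW S) (dW_real S) ι₁ datum) m₁ m₂)).F) :
    ins₃₄ V S hGR η datum m₁ m₂ f φ =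
      isoOp V S hGR η (ins (L : Type) (frameD V) (frameD_real V) (frameD_ne V) (dW S) (dW_real S) (dW_ne S) ι₁ datum m₁ m₂ f φ) := rfl

/-- **the (34) torus on the transported vectors is the transported (12)-type torus at the swapped point**:
`ρ(1, eW (jT₃₄ (ι u))) (ρ(1,h) Ψ) = ρ(1,h) (ρ(archProdHom (1, diag(swap u))) Ψ)`. -/
theorem cmPairRepTwist_jT₃₄_isoOp (u : SeesawArchTorus (L : Type)) (Ψ : CMSchwartz (L : Type) 6) :
    cmPairRepTwist (L : Type) finProdFinEquiv (frameD V) (frameD_real V) (frameD_ne V) (dW S) (dW_real S) (dW_ne S) hGR η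
        ((1 : CMAdelic (L : Type) (frameD V)),
          (cmAdelicEquiv (L : Type) 2 (Matrix.diagonal (dW S)) (S.jT₃₄ (toAdeles (L : Type) u)) : CMAdelic (L : Type) (dW S)))
        (isoOp V S hGR η Ψ) =
      isoOp V S hGR η
        (cmPairRepTwist (L : Type) finProdFinEquiv (frameD V) (frameD_real V) (frameD_ne V) (dW S) (dW_real S) (dW_ne S) hGR η
          (wPair V S (archDiag (L : Type) (dW S) (swapPin S u))) Ψ) := by
  rw [pair_cmAdelicEquiv_jT₃₄_toAdeles, map_mul, map_mul, map_mul, map_mul, Module.End.mul_apply, Module.End.mul_apply,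
    ← Module.End.mul_apply (cmPairRepTwist (L : Type) finProdFinEquiv (frameD V) (frameD_real V) (frameD_ne V) (dW S) (dW_real S) (dW_ne S)
      hGR η (wPair V S (isoTwistPin S)⁻¹)), ← map_mul, ← map_mul, inv_mul_cancel, map_one, map_one, Module.End.one_apply]

/-- **(J-T34) at `a • φ₀`, VALUE currency**: `ρ(1, eW (jT₃₄ (ι u))) (ins₃₄ f (a • φ₀)) = (η · χ_T · ∏ d)(swap u) • ins₃₄ f (a • φ₀)`,
given the per-place torus eigen data `d` of #35/#37 (`hd₁`, `hdι`). -/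
theorem cmPairRepTwist_jT₃₄_ins₃₄_smul_vacuum
    (d : {v : InfinitePlace ↥(maximalRealSubfield L) // v.IsReal} → SeesawArchTorus (L : Type) → ℂ)
    (hd₁ : ∀ w u, (datum ((cmPlacesEquiv (L : Type)).symm w)).kind ≠ .iota → d w u = 1)
    (hdι : ∀ w u, (datum ((cmPlacesEquiv (L : Type)).symm w)).kind = .iota →
      linSubst (star ((reindexUnitary (pairFrame (PosIdx (cmXV (L : Type) (frameD V) (frameD_real V) ι₁ w))
        (NegIdx (cmXV (L : Type) (frameD V) (frameD_real V) ι₁ w)) (PosIdx (cmXW (L : Type) (frameD V) (dW S) (dW_real S) ι₁ w))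
        (NegIdx (cmXW (L : Type) (frameD V) (dW S) (dW_real S) ι₁ w)) finProdFinEquiv (cmEpsV (L : Type) (frameD V) (frameD_real V) ι₁ w)
        (cmEpsW (L : Type) (frameD V) (dW S) (dW_real S) ι₁ w))
        (dualPairι (torusPlaceLetter (L : Type) (frameD V) (frameD_real V) (dW S) (dW_real S) ι₁ w u)) :
          Matrix.unitaryGroup (Fin 6) ℂ) : Matrix (Fin 6) (Fin 6) ℂ))
        (placePoly (L : Type) (frameD V) (frameD_real V) (dW S) (dW_real S) ι₁ datum m₁ m₂
          (fun b => ((printPlaces (InfinitePlace (L : Type)) (kindOf (L : Type) (frameD V) (frameD_real V) (dW S) (dW_real S) ι₁ datum)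
            (lamOf (L : Type) (frameD V) (frameD_real V) (dW S) (dW_real S) ι₁ datum)
            (lamOf_ne_zero (L : Type) (frameD V) (frameD_real V) (dW S) (dW_real S) ι₁ datum)
            (pinnedVacs (kindOf (L : Type) (frameD V) (frameD_real V) (dW S) (dW_real S) ι₁ datum) m₁ m₂)).loc b).φ) w) =
      d w u • placePoly (L : Type) (frameD V) (frameD_real V) (dW S) (dW_real S) ι₁ datum m₁ m₂
          (fun b => ((printPlaces (InfinitePlace (L : Type)) (kindOf (L : Type) (frameD V) (frameD_real V) (dW S) (dW_real S) ι₁ datum)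
            (lamOf (L : Type) (frameD V) (frameD_real V) (dW S) (dW_real S) ι₁ datum)
            (lamOf_ne_zero (L : Type) (frameD V) (frameD_real V) (dW S) (dW_real S) ι₁ datum)
            (pinnedVacs (kindOf (L : Type) (frameD V) (frameD_real V) (dW S) (dW_real S) ι₁ datum) m₁ m₂)).loc b).φ) w)
    (u : SeesawArchTorus (L : Type)) (f : FinSB ↥(maximalRealSubfield L) (Fin 6)) (a : ℂ) :
    cmPairRepTwist (L : Type) finProdFinEquiv (frameD V) (frameD_real V) (frameD_ne V) (dW S) (dW_real S) (dW_ne S) hGR η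
        ((1 : CMAdelic (L : Type) (frameD V)),
          (cmAdelicEquiv (L : Type) 2 (Matrix.diagonal (dW S)) (S.jT₃₄ (toAdeles (L : Type) u)) : CMAdelic (L : Type) (dW S)))
        (ins₃₄ V S hGR η datum m₁ m₂ f
          (a • (printPlaces (InfinitePlace (L : Type)) (kindOf (L : Type) (frameD V) (frameD_real V) (dW S) (dW_real S) ι₁ datum)
            (lamOf (L : Type) (frameD V) (frameD_real V) (dW S) (dW_real S) ι₁ datum)
            (lamOf_ne_zero (L : Type) (frameD V) (frameD_real V) (dW S) (dW_real S) ι₁ datum)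
            (pinnedVacs (kindOf (L : Type) (frameD V) (frameD_real V) (dW S) (dW_real S) ι₁ datum) m₁ m₂)).φ₀)) =
      (((η (archProdHom (↥(maximalRealSubfield L)) (L : Type) (IsCMField.complexConj L) 3 2 (Matrix.diagonal (frameD V))
            (Matrix.diagonal (dW S))
            ((1 : UnitaryGroup.arch (↥(maximalRealSubfield L)) (L : Type) (IsCMField.complexConj L) 3 (Matrix.diagonal (frameD V))),
              archDiag (L : Type) (dW S) (swapPin S u))) : ℂˣ) : ℂ) *
          ((pinTorusChar V S hGR hW (swapPin S u) : Circle) : ℂ) * ∏ w, d w (swapPin S u)) •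
        ins₃₄ V S hGR η datum m₁ m₂ f
          (a • (printPlaces (InfinitePlace (L : Type)) (kindOf (L : Type) (frameD V) (frameD_real V) (dW S) (dW_real S) ι₁ datum)
            (lamOf (L : Type) (frameD V) (frameD_real V) (dW S) (dW_real S) ι₁ datum)
            (lamOf_ne_zero (L : Type) (frameD V) (frameD_real V) (dW S) (dW_real S) ι₁ datum)
            (pinnedVacs (kindOf (L : Type) (frameD V) (frameD_real V) (dW S) (dW_real S) ι₁ datum) m₁ m₂)).φ₀) := by
  rw [ins₃₄_apply, cmPairRepTwist_jT₃₄_isoOp, wPair_apply]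
  have h12 := cmPairRepTwist_jT₁₂_ins_smul_vacuum V S hGR η datum m₁ m₂ hW d hd₁ hdι (swapPin S u) f a
  rw [pair_cmAdelicEquiv_jT₁₂_toAdeles] at h12
  rw [h12, map_smul]

/-! ## §3 The census field `omg_ins` AT `a • φ₀` for the torus `jT₃₄` -/

/-- **`omg_ins` for `jT₃₄` at every scalar multiple of the printed vacuum, from ONE scalar identity on the torus** ((J-μ)₃₄): if
`η(1, diag(u')_𝔸) · χ_T(u') · ∏ d(u') = (w t)⁻¹` with `u' = swap (u_t)` for every printed torus point `t`, then
`ω(ι_T t)(ins₃₄ f (a • φ₀)) = ins₃₄ f (ω_T t (a • φ₀))` for the chart `ι_T = printedTorusHom … (jT₃₄ ∘ ι)`. -/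
theorem omgW_ins₃₄_smul_vacuum_eq_of_weight
    (d : {v : InfinitePlace ↥(maximalRealSubfield L) // v.IsReal} → SeesawArchTorus (L : Type) → ℂ)
    (hd₁ : ∀ w u, (datum ((cmPlacesEquiv (L : Type)).symm w)).kind ≠ .iota → d w u = 1)
    (hdι : ∀ w u, (datum ((cmPlacesEquiv (L : Type)).symm w)).kind = .iota →
      linSubst (star ((reindexUnitary (pairFrame (PosIdx (cmXV (L : Type) (frameD V) (frameD_real V) ι₁ w))
        (NegIdx (cmXV (L : Type) (frameD V) (frameD_real V) ι₁ w)) (PosIdx (cmXW (L : Type) (frameD V) (dW S) (dW_real S) ι₁ w))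
        (NegIdx (cmXW (L : Type) (frameD V) (dW S) (dW_real S) ι₁ w)) finProdFinEquiv (cmEpsV (L : Type) (frameD V) (frameD_real V) ι₁ w)
        (cmEpsW (L : Type) (frameD V) (dW S) (dW_real S) ι₁ w))
        (dualPairι (torusPlaceLetter (L : Type) (frameD V) (frameD_real V) (dW S) (dW_real S) ι₁ w u)) :
          Matrix.unitaryGroup (Fin 6) ℂ) : Matrix (Fin 6) (Fin 6) ℂ))
        (placePoly (L : Type) (frameD V) (frameD_real V) (dW S) (dW_real S) ι₁ datum m₁ m₂
          (fun b => ((printPlaces (InfinitePlace (L : Type)) (kindOf (L : Type) (frameD V) (frameD_real V) (dW S) (dW_real S) ι₁ datum)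
            (lamOf (L : Type) (frameD V) (frameD_real V) (dW S) (dW_real S) ι₁ datum)
            (lamOf_ne_zero (L : Type) (frameD V) (frameD_real V) (dW S) (dW_real S) ι₁ datum)
            (pinnedVacs (kindOf (L : Type) (frameD V) (frameD_real V) (dW S) (dW_real S) ι₁ datum) m₁ m₂)).loc b).φ) w) =
      d w u • placePoly (L : Type) (frameD V) (frameD_real V) (dW S) (dW_real S) ι₁ datum m₁ m₂
          (fun b => ((printPlaces (InfinitePlace (L : Type)) (kindOf (L : Type) (frameD V) (frameD_real V) (dW S) (dW_real S) ι₁ datum)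
            (lamOf (L : Type) (frameD V) (frameD_real V) (dW S) (dW_real S) ι₁ datum)
            (lamOf_ne_zero (L : Type) (frameD V) (frameD_real V) (dW S) (dW_real S) ι₁ datum)
            (pinnedVacs (kindOf (L : Type) (frameD V) (frameD_real V) (dW S) (dW_real S) ι₁ datum) m₁ m₂)).loc b).φ) w)
    (hμ : ∀ t : (printPlaces (InfinitePlace (L : Type)) (kindOf (L : Type) (frameD V) (frameD_real V) (dW S) (dW_real S) ι₁ datum)
        (lamOf (L : Type) (frameD V) (frameD_real V) (dW S) (dW_real S) ι₁ datum)
        (lamOf_ne_zero (L : Type) (frameD V) (frameD_real V) (dW S) (dW_real S) ι₁ datum)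
        (pinnedVacs (kindOf (L : Type) (frameD V) (frameD_real V) (dW S) (dW_real S) ι₁ datum) m₁ m₂)).Tg,
      (((η (archProdHom (↥(maximalRealSubfield L)) (L : Type) (IsCMField.complexConj L) 3 2 (Matrix.diagonal (frameD V))
            (Matrix.diagonal (dW S))
            ((1 : UnitaryGroup.arch (↥(maximalRealSubfield L)) (L : Type) (IsCMField.complexConj L) 3 (Matrix.diagonal (frameD V))),
              archDiag (L : Type) (dW S) (swapPin S (archOf V S datum m₁ m₂ t)))) : ℂˣ) : ℂ) *
          ((pinTorusChar V S hGR hW (swapPin S (archOf V S datum m₁ m₂ t)) : Circle) : ℂ) *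
          ∏ w, d w (swapPin S (archOf V S datum m₁ m₂ t))) =
        (printPlacesW (InfinitePlace (L : Type)) (kindOf (L : Type) (frameD V) (frameD_real V) (dW S) (dW_real S) ι₁ datum)
          (lamOf (L : Type) (frameD V) (frameD_real V) (dW S) (dW_real S) ι₁ datum)
          (lamOf_ne_zero (L : Type) (frameD V) (frameD_real V) (dW S) (dW_real S) ι₁ datum)
          (pinnedVacs (kindOf (L : Type) (frameD V) (frameD_real V) (dW S) (dW_real S) ι₁ datum) m₁ m₂) t)⁻¹)
    (f : FinSB ↥(maximalRealSubfield L) (Fin 6))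
    (t : (printPlaces (InfinitePlace (L : Type)) (kindOf (L : Type) (frameD V) (frameD_real V) (dW S) (dW_real S) ι₁ datum)
      (lamOf (L : Type) (frameD V) (frameD_real V) (dW S) (dW_real S) ι₁ datum)
      (lamOf_ne_zero (L : Type) (frameD V) (frameD_real V) (dW S) (dW_real S) ι₁ datum)
      (pinnedVacs (kindOf (L : Type) (frameD V) (frameD_real V) (dW S) (dW_real S) ι₁ datum) m₁ m₂)).Tg) (a : ℂ) :
    omgW (wmInputCM₂g V S hGR η hη hηc τ T hT)
        (printedTorusHom (kindOf (L : Type) (frameD V) (frameD_real V) (dW S) (dW_real S) ι₁ datum)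
          (lamOf (L : Type) (frameD V) (frameD_real V) (dW S) (dW_real S) ι₁ datum)
          (lamOf_ne_zero (L : Type) (frameD V) (frameD_real V) (dW S) (dW_real S) ι₁ datum)
          (S.jT₃₄.toMonoidHom.comp (toAdeles (L : Type)))
          (pinnedVacs (kindOf (L : Type) (frameD V) (frameD_real V) (dW S) (dW_real S) ι₁ datum) m₁ m₂) t)
        (ins₃₄ V S hGR η datum m₁ m₂ f (a • (printPlaces (InfinitePlace (L : Type)) _ _ _ _).φ₀)) =
      ins₃₄ V S hGR η datum m₁ m₂ f
        ((printPlaces (InfinitePlace (L : Type)) (kindOf (L : Type) (frameD V) (frameD_real V) (dW S) (dW_real S) ι₁ datum)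
          (lamOf (L : Type) (frameD V) (frameD_real V) (dW S) (dW_real S) ι₁ datum)
          (lamOf_ne_zero (L : Type) (frameD V) (frameD_real V) (dW S) (dW_real S) ι₁ datum)
          (pinnedVacs (kindOf (L : Type) (frameD V) (frameD_real V) (dW S) (dW_real S) ι₁ datum) m₁ m₂)).ωT t
          (a • (printPlaces (InfinitePlace (L : Type)) _ _ _ _).φ₀)) := by
  dsimp only [omgW]
  rw [wmInputCM₂g_ρ_eq_of V S hGR η hη hηc τ T hT hW, printedTorusHom_apply]
  change cmPairRepTwist (L : Type) finProdFinEquiv (frameD V) (frameD_real V) (frameD_ne V) (dW S) (dW_real S) (dW_ne S) hGR η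
      ((1 : CMAdelic (L : Type) (frameD V)),
        (cmAdelicEquiv (L : Type) 2 (Matrix.diagonal (dW S)) (S.jT₃₄ (toAdeles (L : Type) (archOf V S datum m₁ m₂ t))) :
          CMAdelic (L : Type) (dW S))) _ = _
  rw [cmPairRepTwist_jT₃₄_ins₃₄_smul_vacuum V S hGR η datum m₁ m₂ hW d hd₁ hdι (archOf V S datum m₁ m₂ t) f a, hμ t]
  simp only [map_smul, printPlaces_ωT_φ₀]
  rw [smul_comm]

/-- **`omg_ins` for `jT₃₄` AT `a • φ₀` FOR THE CHOSEN PLACE DATA `datumAt`** (the (34) twin of #39): from ONE scalar identity `hμ`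
on the torus, read at the swapped point `swap (u_t)` with #39's per-place scalars `dAt`. -/
theorem omgW_ins₃₄_vacuum_datumAt_eq_of_weight (jD : InfinitePlace (L : Type) → HodgeCM.PerL34.Fock.EqVar → Fin 6)
    (hμ : ∀ t : (printPlaces (InfinitePlace (L : Type))
        (kindOf (L : Type) (frameD V) (frameD_real V) (dW S) (dW_real S) ι₁ (datumAt V S jD (jIOf V S hW)))
        (lamOf (L : Type) (frameD V) (frameD_real V) (dW S) (dW_real S) ι₁ (datumAt V S jD (jIOf V S hW)))
        (lamOf_ne_zero (L : Type) (frameD V) (frameD_real V) (dW S) (dW_real S) ι₁ (datumAt V S jD (jIOf V S hW)))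
        (pinnedVacs (kindOf (L : Type) (frameD V) (frameD_real V) (dW S) (dW_real S) ι₁ (datumAt V S jD (jIOf V S hW))) m₁ m₂)).Tg,
      (((η (archProdHom (↥(maximalRealSubfield L)) (L : Type) (IsCMField.complexConj L) 3 2 (Matrix.diagonal (frameD V))
            (Matrix.diagonal (dW S))
            ((1 : UnitaryGroup.arch (↥(maximalRealSubfield L)) (L : Type) (IsCMField.complexConj L) 3 (Matrix.diagonal (frameD V))),
              archDiag (L : Type) (dW S) (swapPin S (archOf V S (datumAt V S jD (jIOf V S hW)) m₁ m₂ t)))) : ℂˣ) : ℂ) *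
          ((pinTorusChar V S hGR hW (swapPin S (archOf V S (datumAt V S jD (jIOf V S hW)) m₁ m₂ t)) : Circle) : ℂ) *
          dIotaAt (L : Type) (frameD V) (dW S) (dW_real S) ι₁ (swapPin S (archOf V S (datumAt V S jD (jIOf V S hW)) m₁ m₂ t))) =
        (printPlacesW (InfinitePlace (L : Type))
          (kindOf (L : Type) (frameD V) (frameD_real V) (dW S) (dW_real S) ι₁ (datumAt V S jD (jIOf V S hW)))
          (lamOf (L : Type) (frameD V) (frameD_real V) (dW S) (dW_real S) ι₁ (datumAt V S jD (jIOf V S hW)))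
          (lamOf_ne_zero (L : Type) (frameD V) (frameD_real V) (dW S) (dW_real S) ι₁ (datumAt V S jD (jIOf V S hW)))
          (pinnedVacs (kindOf (L : Type) (frameD V) (frameD_real V) (dW S) (dW_real S) ι₁ (datumAt V S jD (jIOf V S hW))) m₁ m₂) t)⁻¹)
    (f : FinSB ↥(maximalRealSubfield L) (Fin 6))
    (t : (printPlaces (InfinitePlace (L : Type))
        (kindOf (L : Type) (frameD V) (frameD_real V) (dW S) (dW_real S) ι₁ (datumAt V S jD (jIOf V S hW)))
        (lamOf (L : Type) (frameD V) (frameD_real V) (dW S) (dW_real S) ι₁ (datumAt V S jD (jIOf V S hW)))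
        (lamOf_ne_zero (L : Type) (frameD V) (frameD_real V) (dW S) (dW_real S) ι₁ (datumAt V S jD (jIOf V S hW)))
        (pinnedVacs (kindOf (L : Type) (frameD V) (frameD_real V) (dW S) (dW_real S) ι₁ (datumAt V S jD (jIOf V S hW))) m₁ m₂)).Tg)
    (a : ℂ) :
    omgW (wmInputCM₂g V S hGR η hη hηc τ T hT)
        (printedTorusHom (kindOf (L : Type) (frameD V) (frameD_real V) (dW S) (dW_real S) ι₁ (datumAt V S jD (jIOf V S hW)))
          (lamOf (L : Type) (frameD V) (frameD_real V) (dW S) (dW_real S) ι₁ (datumAt V S jD (jIOf V S hW)))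
          (lamOf_ne_zero (L : Type) (frameD V) (frameD_real V) (dW S) (dW_real S) ι₁ (datumAt V S jD (jIOf V S hW)))
          (S.jT₃₄.toMonoidHom.comp (toAdeles (L : Type)))
          (pinnedVacs (kindOf (L : Type) (frameD V) (frameD_real V) (dW S) (dW_real S) ι₁ (datumAt V S jD (jIOf V S hW))) m₁ m₂) t)
        (ins₃₄ V S hGR η (datumAt V S jD (jIOf V S hW)) m₁ m₂ f (a • (printPlaces (InfinitePlace (L : Type)) _ _ _ _).φ₀)) =
      ins₃₄ V S hGR η (datumAt V S jD (jIOf V S hW)) m₁ m₂ f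
        ((printPlaces (InfinitePlace (L : Type))
          (kindOf (L : Type) (frameD V) (frameD_real V) (dW S) (dW_real S) ι₁ (datumAt V S jD (jIOf V S hW)))
          (lamOf (L : Type) (frameD V) (frameD_real V) (dW S) (dW_real S) ι₁ (datumAt V S jD (jIOf V S hW)))
          (lamOf_ne_zero (L : Type) (frameD V) (frameD_real V) (dW S) (dW_real S) ι₁ (datumAt V S jD (jIOf V S hW)))
          (pinnedVacs (kindOf (L : Type) (frameD V) (frameD_real V) (dW S) (dW_real S) ι₁ (datumAt V S jD (jIOf V S hW))) m₁ m₂)).ωT t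
          (a • (printPlaces (InfinitePlace (L : Type)) _ _ _ _).φ₀)) := by
  refine omgW_ins₃₄_smul_vacuum_eq_of_weight V S hGR η hη hηc τ T hT (datumAt V S jD (jIOf V S hW)) m₁ m₂ hW (dAt V S)
    (fun w u hk => ?_) (fun w u hk => ?_) (fun t => ?_) f t a
  · -- off `ι₁`: the scalar is `1`
    unfold dAt
    rw [if_neg]
    intro h
    exact hk (h ▸ datumAt_kind_of_eq V S jD (jIOf V S hW) _ (by rw [Equiv.apply_symm_apply, h]))
  · -- at `ι₁`: the chosen identification makes `det z` a letter eigenvector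
    obtain rfl := eq_cmPlace_of_datumAt_kind V S jD (jIOf V S hW) w hk
    unfold dAt
    rw [if_pos rfl]
    exact linSubst_torusLetter_placePoly_vacuum_iotaAt (L : Type) (frameD V) (frameD_real V) (dW S) (dW_real S) ι₁
      (frameD_sign_ι₁ V) hW (datumAt V S jD (jIOf V S hW)) m₁ m₂
      (datumAt_of_eq V S jD (jIOf V S hW) _ (Equiv.apply_symm_apply _ _)) u
  · rw [prod_dAt]
    exact hμ t

/-! ## §4 `ins₃₄` takes values in `𝒮^κ` whenever `ins` does -/

include hW in
/-- **`𝒮^κ` is `ρ(1,·)`-stable, so the (34) insertion inherits `ins_mem` from the (12) insertion** (NO new hypothesis). -/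
theorem ins₃₄_mem_SK (f : FinSB ↥(maximalRealSubfield L) (Fin 6))
    (φ : (printPlaces (InfinitePlace (L : Type)) (kindOf (L : Type) (frameD V) (frameD_real V) (dW S) (dW_real S) ι₁ datum)
      (lamOf (L : Type) (frameD V) (frameD_real V) (dW S) (dW_real S) ι₁ datum)
      (lamOf_ne_zero (L : Type) (frameD V) (frameD_real V) (dW S) (dW_real S) ι₁ datum)
      (pinnedVacs (kindOf (L : Type) (frameD V) (frameD_real V) (dW S) (dW_real S) ι₁ datum) m₁ m₂)).F)
    (h : ins (L : Type) (frameD V) (frameD_real V) (frameD_ne V) (dW S) (dW_real S) (dW_ne S) ι₁ datum m₁ m₂ f φ ∈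
      (wmInputCM₂g V S hGR η hη hηc τ T hT).SK) :
    ins₃₄ V S hGR η datum m₁ m₂ f φ ∈ (wmInputCM₂g V S hGR η hη hηc τ T hT).SK := by
  have hst := (wmInputCM₂g V S hGR η hη hηc τ T hT).SK_stable
    (archToAdelic (↥(maximalRealSubfield L)) (L : Type) (IsCMField.complexConj L) 2 (Matrix.diagonal (dW S)) (isoTwistPin S)) _ h
  rw [wmInputCM₂g_ρ_eq_of V S hGR η hη hηc τ T hT hW] at hst
  have e : wPair V S (isoTwistPin S) =
      ((1 : CMAdelic (L : Type) (frameD V)),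
        archToAdelic (↥(maximalRealSubfield L)) (L : Type) (IsCMField.complexConj L) 2 (Matrix.diagonal (dW S)) (isoTwistPin S)) :=
    Prod.ext (map_one (archToAdelic (↥(maximalRealSubfield L)) (L : Type) (IsCMField.complexConj L) 3 (Matrix.diagonal (frameD V)))) rfl
  have key : isoOp V S hGR η =
      cmPairRepTwist (L : Type) finProdFinEquiv (frameD V) (frameD_real V) (frameD_ne V) (dW S) (dW_real S) (dW_ne S) hGR η
        ((1 : CMAdelic (L : Type) (frameD V)),
          archToAdelic (↥(maximalRealSubfield L)) (L : Type) (IsCMField.complexConj L) 2 (Matrix.diagonal (dW S)) (isoTwistPin S)) :=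
    congrArg (cmPairRepTwist (L : Type) finProdFinEquiv (frameD V) (frameD_real V) (frameD_ne V) (dW S) (dW_real S) (dW_ne S) hGR η) e
  show isoOp V S hGR η (ins (L : Type) (frameD V) (frameD_real V) (frameD_ne V) (dW S) (dW_real S) (dW_ne S) ι₁ datum m₁ m₂ f φ) ∈
    (wmInputCM₂g V S hGR η hη hηc τ T hT).SK
  rw [key]
  exact hst

end Pin

end HodgeCM.Model.HypCensus

end
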